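import Literature.NumberTheory.EllipticCurves.BDPAnticyclotomicPAdicLFunction
import Literature.NumberTheory.EllipticCurves.Tamagawa
import HarnessLib

/-!
# Castella 2024 (arXiv:2409.01360v1, UNREFEREED), §2.1 + §2.3: the BDP anticyclotomic `p`-adic
# `L`-function `L_𝔭(f) ∈ Λ_{R₀}` at a prime `p ∥ N` of MULTIPLICATIVE reduction, for ANY conductor `N`
# (`E` not assumed semistable) — Castella 2018 Thm. 3.1's frame, BY CITATION to Hsieh 2014 Thm. A and
# Castella, J. Inst. Math. Jussieu 17 (2018), Thms. 2.10–2.11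

HONEST FRAMING. Trunk `Literature/NumberTheory/EllipticCurves`, directory `Castella2024/` (the paper's
other typed items: `MultiplicativePConverse.lean`, `MultiplicativeHeegnerPointMainConjecture.lean`,
`LambdaAdicHeegnerClass*.lean`, `ExceptionalZeroProofs.lean`). ONE named fact (`def … : Prop`; nothing
asserted, no instance, no notation, no `sorry`): the SIBLING of the tree's A206
`Literature.NumberTheory.EllipticCurves.castella2018_exists_isBDPLFunction` (Castella, Camb. J. Math. 6
(2018), Thm. 3.1, in the `∃`-currency «CM periods `Ω_K ∈ ℂ^×`, `Ω_p ∈ R₀^×` and `L ∈ R₀⟦T⟧ = Λ_{R₀}`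
with the interpolation predicate `IsBDPLFunction ι 𝔭 κ γ f Ω_K Ω_p L`», file
`BDPAnticyclotomicPAdicLFunction.lean`) with A206's binder `Squarefree N` (Castella 2018, §2.1: «`E`
semistable») REPLACED by the standing hypotheses of Castella 2024, §2.1 — `E/ℚ` of conductor `N`,
`p ≥ 5` a prime of MULTIPLICATIVE reduction (`p ∥ N`, the rest of `N` arbitrary), `K` imaginary
quadratic of odd discriminant `< −4` with the Heegner hypothesis — under which §2.3 of that paper
writes «denote by `L_𝔭(f) ∈ Λ_{R₀}` the `p`-adic Rankin `L`-function of Bertolini–Darmon–Prasanna [bdp],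
as extended in [hsieh, cas-split] to the `p`-multiplicative case». Typed by the ideator seat
`bsd-idea-9` (g45, 2026-08-30) of cell `bsd-stepL`'s crux `EulerHalfNotRamNoInertSetAtFive` (item
stmt-BirchSwinnertonDyer-19715) for the door skeleton
`Summits/BirchSwinnertonDyer/BirchSwinnertonDyer/Cruxes/EulerHalfNotRamNoInertSetAtFive/BstwZetaNonsplitDoorSketch.lean`,
whose print-shaped stub `stub_bdpFramePrintMultiplicative` (rev 3.6–3.8) IS the statement below (the
cell's TYPER REQUEST of 2026-08-30T10:58Z, `pub/bsd-stepL/INBOX.md`); the members of that crux's class are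
never semistable, so A206 serves none of them. Typed ≠ proved ≠ endorsed; the flags below say exactly
what is printed where.

NEAREST TREE DECLARATIONS (searched; none restated): A206 `castella2018_exists_isBDPLFunction`
(`Squarefree N`; `p ∤ N` allowed); `castellaHsieh2018_exists_isBDPLFunction` (`p ∤ N`, GOOD reduction,
file `CastellaHsieh2018/BDPLFunctionExistence.lean`); `Castella2018.thm32_exists_isBDPLFunction_valueAtOne`
(Thms. 3.1–3.2, `Squarefree N`); `Castella2018.erratum_exists_frames_members_sigma_congruence` (the same
`R₀`-frame conjunct at `p ∥ N` WITHOUT `Squarefree N`, but only at ERRATUM data: a second multiplicative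
prime `q`, non-split in `K`, with `E[p]` ramified at `q` — absent on the all-split Heegner fields used
here); `castella2018Exceptional_bdpValueContinuity_trivialChar` (J. Inst. Math. Jussieu 17 Thms.
2.10–2.11 at `p ∥ N`, any conductor, in the FRAME-FREE currency «value continuity at `𝟙`» — no `R₀`, no
`Λ`-adic element; file `BDPValueContinuityMultiplicativePrime.lean`); `KellerYin2024.…` (frame packaged
inside Thm. D at an EISENSTEIN `p ∥ N`, flag `KYD-frame`). The present statement — the bare `R₀`-frame at
a multiplicative `p ≥ 5` with `E[p]` irreducible and NO square-freeness — is none of these.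

## The sources, verbatim (TeX e-print of record `run/shared/lean/pub/bsd-eis/lit/src/cas24-src/
## multiplicative-conv.tex`, line locators `l.NNN`; store texts `[corpus: paper:arxiv-2409.01360]`,
## `[corpus: paper:arxiv-1112.1580]`, `[corpus: paper:arxiv-1507.04260]` with chunk:line locators)

* **[Cas24] §2.1 «Setting»** (l.358): «Let `E/ℚ` be an elliptic curve of conductor `N`, let
  `f ∈ S₂(Γ₀(N))` be the newform associated to `E`, and let `p` be a prime of multiplicative reduction
  for `E`, so `p ∥ N`. Throughout we assume that `p > 3`»; (l.360): «Let `K` be an imaginary quadratic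
  field of odd discriminant `−D_K < −4` and ring of integers `𝒪_K` such that (Heeg) holds» — (Heeg) =
  §1.1 l.258–261: «there exists an ideal `𝔑 ⊂ 𝒪_K` with `𝒪_K/𝔑 ≃ ℤ/Nℤ`»; (l.366–370): «In particular,
  the prime `p` splits in `K`, say `p = 𝔭𝔭̄`, with `𝔭` the prime of `K` above `p` induced by a fixed
  embedding `ı_p : ℚ̄ ↪ ℚ̄_p`.» **§2.3** (l.465–469): «Let `R₀ = ℤ̂_p^{nr}` denote the completion of the
  ring of integers of the maximal unramified extension of `ℚ_p`, set `Λ_{R₀} = Λ ⊗̂_{ℤ_p} R₀`, and denote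
  by `L_𝔭(f) ∈ Λ_{R₀}` the `p`-adic Rankin `L`-function of Bertolini–Darmon–Prasanna [bdp], as extended
  in [hsieh, cas-split] to the `p`-multiplicative case.» Proof of Thm. 2.2 (l.618): «By the same
  calculation as in [cas-hsieh1, Thm. 5.7], but replacing the appeal … to results from [bdp] by their
  corresponding extension in [cas-split] to the multiplicative case». Bibliography (`.bbl`): [hsieh] =
  M.-L. Hsieh, Doc. Math. 19 (2014) 709–767; [cas-split] = F. Castella, J. Inst. Math. Jussieu 17
  (2018) 207–240; [cas-hsieh1] = Castella–Hsieh, Math. Ann. 370 (2018); [bdp] = Duke Math. J. 162 (2013).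
* **[Hsi14] Theorem A** (e-print arXiv:1112.1580, p0004 L13–L14; journal Thm. A): setting p0003 L4
  («`𝓕` totally real …, `𝒦` a totally imaginary quadratic extension of `𝓕` …, `π` an irreducible
  cuspidal automorphic representation of `GL₂(𝔸_𝓕)`»), L20–L22 («`π` has infinity type `k = Σ k_σ σ`,
  `λ` has infinity type `(k/2, −k/2)` … Hypothesis (ST). The local root number
  `ε*(π_{𝒦_v}, λ_v) = +1` for each `v ∣ 𝔫⁻`» — `𝔫 = 𝔫⁺𝔫⁻` the conductor OF `π`, `𝔫⁻` its part at
  primes inert or ramified in `𝒦`), L24–L26 («Let `p` be an odd rational prime … (ord) `Σ` is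
  `p`-ordinary»), p0004 L1 («Let `𝔑` be the prime-to-`p` conductor of `π_𝒦 ⊗ λ`»), and the theorem:
  «In addition to (ord) and (ST), we further assume that (sf) `𝔫⁻` is square-free. Then there exists an
  element `𝒫_Σ(π, λ) ∈ Λ` [`= Z̄_p⟦Γ⁻⟧`] such that for every `φ̂` … of weight `(m, −m)`» the displayed
  square-root interpolation formula holds; L22: «We shall call `𝓛_Σ(π,λ) := 𝒫_Σ(π,λ)²` the
  anticyclotomic `L`-function … When `𝓕 = ℚ`, `π` is unramified at `p` and `𝔫⁻` is only divisible by
  primes ramified in `𝒦`, `𝓛_Σ(π, λ)` is constructed in [BDP]». NO hypothesis on `π` AT `p`: only the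
  prime-to-`p` conductor and `𝔫⁻` are constrained — the sense of [Cas24]'s «extended in [hsieh] to the
  `p`-multiplicative case». PUBLISHED / REFEREED.
* **[JIMJ18] = [cas-split]** (arXiv:1507.04260): setting p0003 L3–L5 («Fix a prime `p ≥ 5`, an integer
  `N > 0` prime to `p`, and let `f ∈ S₂(Γ₀(Np))` be a newform» — ANY `N`; the paper's standing
  `a_p(f) = 1` concerns its big-Heegner-point results), §1.5 p0007 L29–L33 («`𝒪_K/𝔑 ≃ ℤ/Nℤ`»), L66–L68
  («we shall assume that `p = 𝔭𝔭̄` splits in `K`, and let `𝔭` be the prime of `K` above `p` induced by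
  our fixed embedding»); **Thm. 2.10** (p0013 L119–L131): «The assignment `χ ↦ L_𝔭(f)(χ)` extends to a
  continuous function on `Σ̂_{k,c}` and satisfies the following interpolation property … `L_𝔭(f)(χ)²/
  Ω_p^{2(k+2j)} = (1 − a_p(f)χ⁻¹(𝔭̄))² · L_alg(f, χ⁻¹, 0)`. Proof. See Theorem 5.9, Proposition 5.10, and
  equation (5.2.4) of [bdp1], noting that `β_p = 0` here, since `f` has level divisible by `p`»;
  **Thm. 2.11** (p0014 L1–L12, «a `p`-new eigenform» of level `Γ₀(Np)`, `a_p(f)` symbolic). PUBLISHED.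
* **[Cas18] Thm. 3.1** (Camb. J. Math. 6 (2018) = arXiv:1704.06608 p. 9; quoted in full in the module
  docstring of `BDPAnticyclotomicPAdicLFunction.lean`): «There exists a `p`-adic `L`-function
  `L_p(f) ∈ Λ_{R₀}` such that … `L_p(f, φ̂) = Γ(n)Γ(n+1) · (1 − a_p p⁻¹ φ(𝔭) + ε_p φ²(𝔭))² · Ω_p^{4n} ·
  L(f/K, φ, 1)/(π^{2n+1} Ω_K^{4n})`, where `ε_p = p⁻¹` if `p ∤ N` and `ε_p = 0` otherwise, and `Ω_p ∈ R₀^×`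
  and `Ω_K ∈ ℂ^×` are CM periods» — the case `p ∣ N` INCLUDED, printed under §2.1 «`E` semistable»;
  proof: «the construction in [cas-hsieh1] readily extends to the case `p ∣ N` … (cf. [cas-split])».
  This display IS the tree's `IsBDPLFunction` (transport along `ι⁻¹`). PUBLISHED / REFEREED.
* **[KY24] §5.1 (b)** (arXiv:2402.12781v2, TeX L1743; tree flag `KYD-frame` of
  `KellerYin2024/MultiplicativeReduction.lean`): at `p ∥ N` «a `2`-variable `p`-adic `L`-function … for
  the Hida families constructed in [Cas20, Theorem 2.11]» ([Cas20] = J. Inst. Math. Jussieu 19 (2020)).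

## What is typed, and why it is the printed object (weight `2`, `F = ℚ`)

Binders (verbatim the door stub's, which are A206's at A206's granularity with the substitution just
described): the embedding datum `ι : ℚ̄_p ≃ ℂ` and the elliptic curve `W/ℚ` with its newform `f` at
level `N` (`IsNewformOf W f`); «conductor `N`» — `W.conductorNorm ℤ = N`; «`p > 3`» — `5 ≤ p`;
«multiplicative reduction at `p`, so `p ∥ N`» — `W.HasMultiplicativeReductionAtPrime p`; `E[p]`
irreducible — `W.HasIrreducibleModPGaloisRep p` (NOT a hypothesis of [Cas24] §2.1–2.3; KEPT from A206's
standing list, flag `C23-irr`); «`K` imaginary quadratic of odd discriminant `−D_K < −4`» —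
`IsImaginaryQuadratic K`, `Odd (discr K)`, `discr K < −4`; (Heeg) in the ALL-SPLIT form «every prime
`ℓ ∣ N` splits in `K`» (`((ℓ)).primesOver.ncard = 2`; definitionally the tree's
`SatisfiesHeegnerHypothesis N K`; it implies the printed ideal form and, as `p ∣ N`, «`p` splits»; flag
`C23-Heeg`); «`𝔭` the prime above `p` induced by `ı_p`» — `p ∈ 𝔭` and the compatibility clause of A206
verbatim (`k ∈ 𝔭 ↔ |ι⁻¹(w(k))|_p < 1` for the embedding `w` of the infinite place); `κ` THE anticyclotomic
`ℤ_p`-extension with topological generator `γ` (§2.2–2.3: `Γ = Gal(K_∞/K)`, `Λ = ℤ_p⟦Γ⟧`). Conclusion =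
A206's conclusion verbatim: `∃ Ω_K ≠ 0, Ω_p ∈ R₀^×, L ∈ R₀⟦T⟧, IsBDPLFunction ι 𝔭 κ γ f Ω_K Ω_p L`.
Why this is [Cas24]'s `L_𝔭(f) ∈ Λ_{R₀}`: (D1) [Hsi14] Thm. A applies verbatim to
`(𝓕, 𝒦, π, p) = (ℚ, K, π_f, p)` whatever the level of `f` AT `p` — its hypotheses constrain `𝔫⁻`
((ST), (sf): vacuous under the all-split (Heeg), `𝔫⁻ = 1`) and the CM type ((ord) ⟺ `p` split) — and
gives the `Λ`-adic element; (D2) the passage from Hsieh's ∕ Castella–Hsieh's `𝓛_{𝔭,ψ}(f)` to Castella's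
`L_p(f) ∈ Λ_{R₀}` with the display `IsBDPLFunction` (twist `Tw_{ψ⁻¹}`, `Γ̃ ↠ Γ`, CM periods `Ω_K`,
`Ω_p ∈ R₀^×`) is [CH18] §3.3 ∕ Prop. 3.8 and [Cas18] Thm. 3.1, printed at `p ∤ N` resp. for semistable
`E` (with `ε_p = 0` at `p ∣ N`), a construction that never looks at the reduction of `E` away from `p`;
(D3) at level `Γ₀(Np)`, ANY `N` prime to `p`, [JIMJ18] Thms. 2.10–2.11 print the same values
(continuous-function currency); (D4) [Cas24] §2.3 ∕ proof of Thm. 2.2 and [KY24] §5.1 (b) USE the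
`Λ_{R₀}`-valued object at `p ∥ N` without square-freeness. The statement is therefore the printed
object of [Cas24] §2.3 in the tree's frame currency; the existential periods make it WEAKER than, and
implied by, the cited constructions, exactly as for A206.

## Flags (nothing hidden)

* `C23-cite` (FRAME BY CITATION): no single refereed theorem prints the display `IsBDPLFunction` with
  `L ∈ R₀⟦T⟧`, `Ω_p ∈ R₀^×` for a NON-semistable `E` at `p ∥ N`. Refereed: the `Λ`-adic construction
  [Hsi14] Thm. A (covers any level at `p`), the level-`Γ₀(Np)` values [JIMJ18] Thms. 2.10–2.11, and the
  display [Cas18] Thm. 3.1 (semistable `E`, `p ∣ N` included). The assertion that these give THIS frame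
  at non-square-free `N` is printed only as standing notation ∕ by citation: [Cas24] §2.3 and proof of
  Thm. 2.2, [KY24] §5.1 (b) — both UNREFEREED (arXiv v1 of 2 Sep 2024; v2 of arXiv:2402.12781). Same
  status as the tree flags `Cas18-Thm32-pN-via-cas-split` (`Castella2018/PAdicWaldspurgerFormula.lean`)
  and `JIMJ18-VC-dictionary-via-Cas18` (`BDPValueContinuityMultiplicativePrime.lean`). A consumer citing
  this `Prop` as settled mathematics must carry the flag.
* `C23-Heeg` (WEAKER than print): (Heeg) typed in the all-split form (= `SatisfiesHeegnerHypothesis`),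
  stricter than [Cas24]'s ideal form `𝒪_K/𝔑 ≃ ℤ/Nℤ` (which allows ramified `q ∥ N`); «`p` splits» is then
  automatic (`p ∣ N`) and is not a separate binder.
* `C23-irr` (EXTRA hypothesis, WEAKER than print): `E[p]` irreducible is A206's ([Cas18] §2.1), not
  [Cas24] §2.1–2.3's; kept for binder parity with A206 (the door skeleton's members have surjective
  `ρ̄_{E,p}`).
* `C23-disc` (as printed, not needed by the constructions): `d_K` odd and `< −4` are [Cas24]'s standing
  hypotheses; [Hsi14] has neither, [BDP13] Thm. 4.6 takes `c`, `d_K` odd «for convenience».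
* Typing risk recorded by the requesting cell (door docstring, «Why it might fail»): if at some
  non-semistable level the cited extension only yielded `Ω_p ∉ R₀^×` or `L ∉ R₀⟦T⟧` (a `ψ`-twisted or
  `Λ ⊗ ℚ_p`-valued normalisation), the `UnrSeries` ∕ `(unrIntegers p)ˣ` currency — [Cas24] §2.3's printed
  `Λ_{R₀}` and [Cas18] Thm. 3.1's printed `R₀^×` — would be the misstatement, not the existence.
* PROVENANCE: PUBLISHED constructions ([Hsi14], [JIMJ18], [CH18], [Cas18]) ∘ by-citation normalisation
  ([Cas24] preprint). Nothing below `p = 5`; nothing at additive `p`; nothing for `E[p]` reducible (that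
  is [KY24]'s Eisenstein setting, typed separately).

## References

* [Castella2024] F. Castella, *Exceptional zeros for Heegner points and `p`-converse to the theorem of
  Gross–Zagier and Kolyvagin*, arXiv:2409.01360v1 (2 Sep 2024): §1.1 (Heeg) (l.258–261), §2.1 (l.358–370),
  §2.3 (l.465–469), proof of Thm. 2.2 (l.618).
* [Hsieh2014] M.-L. Hsieh, *Special values of anticyclotomic Rankin–Selberg `L`-functions*,
  Doc. Math. 19 (2014) 709–767 (e-print arXiv:1112.1580): Thm. A (journal p. 712) with (ST), (ord), (sf)
  (e-print p0003–p0004).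
* [Castella2018Exceptional] F. Castella, *On the exceptional specializations of big Heegner points*,
  J. Inst. Math. Jussieu 17 (2018) 207–240 (arXiv:1507.04260): §1 (p. 3), §1.5, Thm. 2.10, Thm. 2.11.
* [Castella2018] F. Castella, *On the `p`-part of the Birch–Swinnerton-Dyer formula for multiplicative
  primes*, Camb. J. Math. 6 (2018): §2.1–2.2, Thm. 3.1 and its proof (arXiv:1704.06608 pp. 5, 9).
* [CastellaHsieh2018] F. Castella, M.-L. Hsieh, *Heegner cycles and `p`-adic `L`-functions*, Math. Ann.
  370 (2018): §3.3, Def. 3.7, Prop. 3.8 (the `p ∤ N` construction and its dictionary to [Hsi14]).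
* [BertoliniDarmonPrasanna2013] Duke Math. J. 162 (2013): §5, Thm. 5.9, Prop. 5.10, (5.2.4).
* [KellerYin2024] arXiv:2402.12781v2, §5.1 (b) (TeX L1743); [Castella2020JIMJ] J. Inst. Math. Jussieu 19
  (2020), Thm. 2.11.
* Cell documents: door skeleton `Summits/…/Cruxes/EulerHalfNotRamNoInertSetAtFive/BstwZetaNonsplitDoorSketch.lean`
  (rev 3.8, docstring of `stub_bdpFramePrintMultiplicative`); crux idea card
  `Summits/…/Cruxes/EulerHalfNotRamNoInertSetAtFive/Ideas/bstw-zeta-nonsplit-door.md`;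
  `run/shared/lean/pub/bsd-stepL/INBOX.md` (TYPER REQUEST 2026-08-30T10:58Z).
-/

noncomputable section

open scoped Classical

open NumberField IsDedekindDomain Field Literature.NumberTheory.EllipticCurves.ModularForms

namespace Literature.NumberTheory.EllipticCurves.Castella2024

/-- **Castella 2024, §2.1 + §2.3 (arXiv:2409.01360v1, UNREFEREED) — the BDP anticyclotomic `p`-adic
`L`-function `L_𝔭(f) ∈ Λ_{R₀}` with its interpolation property at a prime `p ≥ 5` of MULTIPLICATIVE
reduction, ANY conductor, «as extended in [Hsieh 2014, Castella JIMJ 2018] to the `p`-multiplicative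
case»; FRAME BY CITATION (flag `C23-cite`)** — named fact, in the currency of the tree's A206
`castella2018_exists_isBDPLFunction` (Castella 2018 Thm. 3.1: CM periods `Ω_K ∈ ℂ^×`, `Ω_p ∈ R₀^×` and
`L ∈ R₀⟦T⟧` with `IsBDPLFunction ι 𝔭 κ γ f Ω_K Ω_p L`, `ε_p = 0` read off `p ∣ N`), whose binder
`Squarefree N` («`E` semistable», Castella 2018 §2.1) is replaced by Castella 2024 §2.1's standing
hypotheses. For: `f` the newform of the elliptic curve `W/ℚ` at level `N = N_W` (`IsNewformOf W f`,
`W.conductorNorm ℤ = N`); `5 ≤ p` of multiplicative reduction (`p ∥ N`); `E[p]` irreducible (EXTRA, kept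
from A206 — flag `C23-irr`); `K` imaginary quadratic with `d_K` odd and `< −4`; the Heegner hypothesis in
the all-split form «every `ℓ ∣ N` splits in `K`» (= `SatisfiesHeegnerHypothesis N K` definitionally;
stricter than the printed ideal form, flag `C23-Heeg`; it makes `p = 𝔭𝔭̄` split); `𝔭 ∋ p` singled out by
the embedding datum `ι : ℚ̄_p ≃ ℂ` (A206's compatibility clause verbatim); `κ` THE anticyclotomic
`ℤ_p`-extension, `γ` a topological generator. Conclusion: A206's, verbatim. Printed support (module
docstring, with locators): the `Λ`-adic construction is Hsieh 2014 Thm. A (REFEREED; no hypothesis on the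
level at `p` — (ST), (sf) vacuous under the all-split (Heeg), (ord) = `p` split), the level-`Γ₀(Np)`
values for any `N` are Castella JIMJ 17 (2018) Thms. 2.10–2.11 (REFEREED), the display is Castella 2018
Thm. 3.1 (REFEREED, semistable `E`, `p ∣ N` included: «readily extends to the case `p ∣ N` (cf.
[cas-split])»); that these give THIS frame at non-square-free `N` is asserted in print by citation only
(Castella 2024 §2.3 and proof of Thm. 2.2; Keller–Yin 2024 §5.1 (b)) — take it as an explicit hypothesis
`(h : Castella2024.exists_isBDPLFunction_multiplicative)` and carry the flag. Nothing below `p = 5`.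
[cite: Castella2024, §2.1 (l.358–370) and §2.3 (l.465–469): «L_𝔭(f) ∈ Λ_{R₀} … as extended in [hsieh, cas-split] to the p-multiplicative case»; proof of Thm. 2.2 (l.618)]
[cite: Hsieh2014, Thm. A (p. 712) with (ST), (ord), (sf) (arXiv:1112.1580 p0003 L20–L26, p0004 L1–L22)]
[cite: Castella2018Exceptional, Thm. 2.10 and Thm. 2.11 with §1 and §1.5 (arXiv:1507.04260 pp. 3, 7, 13–14)]
[cite: Castella2018, Thm. 3.1 and its proof (arXiv:1704.06608 p. 9), the normalisation `IsBDPLFunction`]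
[cite: CastellaHsieh2018, §3.3, Def. 3.7, Prop. 3.8] [cite: KellerYin2024, §5.1 (b)] -/
def exists_isBDPLFunction_multiplicative : Prop :=
  ∀ {p : ℕ} [Fact p.Prime] (ι : PadicAlgCl p ≃+* ℂ) (W : WeierstrassCurve ℚ) [W.IsElliptic]
    (K : Type) [Field K] [NumberField K] (𝔭 : HeightOneSpectrum (𝓞 K))
    (κ : ZpExtension K p) (γ : absoluteGaloisGroup K) {N : ℕ} [NeZero N]
    {f : CuspForm (CongruenceSubgroup.Gamma0 N) 2} (_ : IsNewformOf W f),
    5 ≤ p → W.conductorNorm ℤ = N → W.HasMultiplicativeReductionAtPrime p →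
    W.HasIrreducibleModPGaloisRep p →
    IsImaginaryQuadratic K → Odd (NumberField.discr K) → NumberField.discr K < -4 →
    (∀ ℓ : ℕ, ℓ.Prime → ℓ ∣ N → ((Ideal.span {(ℓ : ℤ)}).primesOver (𝓞 K)).ncard = 2) →
    ((p : ℕ) : 𝓞 K) ∈ 𝔭.asIdeal →
    (∀ (w : InfinitePlace K) (k : 𝓞 K), k ∈ 𝔭.asIdeal ↔ ‖ι.symm (w.embedding (k : K))‖ < 1) →
    κ.IsAnticyclotomic → κ.IsTopGenerator γ →
    ∃ (ΩK : ℂ) (Ωp : (unrIntegers p)ˣ) (L : UnrSeries p),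
      ΩK ≠ 0 ∧ IsBDPLFunction ι 𝔭 κ γ f ΩK ((Ωp : unrIntegers p) : ℂ_[p]) L

end Literature.NumberTheory.EllipticCurves.Castella2024

end
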